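import Mathlib
import Literature.RepresentationTheory.FiniteGroups.AlternatingGroupMinimalDegree
import Literature.RepresentationTheory.FiniteGroups.IndexTwoRestriction
import Literature.RepresentationTheory.FiniteGroups.CliffordCorrespondence
import Literature.RepresentationTheory.FiniteGroups.InducedCharacter
import Literature.RepresentationTheory.FiniteGroups.SymmetricGroupIsotypic
import Literature.NumberTheory.DiophantineGeometry.SymmetricGroupRepsSignTwist
import Literature.GroupTheory.QuasirandomGroups.AlternatingProductMixingProofs
import Summits.MatrixMultiplication.MatrixMultiplication.Theorems.SnSubsetDichotomyPolynomialSlackSpechtBranching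
import Summits.MatrixMultiplication.MatrixMultiplication.Theorems.SnSubsetDichotomyPolynomialSlackSpechtDimLower
import Summits.MatrixMultiplication.MatrixMultiplication.Theorems.SnSubsetDichotomyPolynomialSlackHookCharacters
import Summits.ValiantsHypothesis.ValiantsHypothesis.Theorems.MonotoneRestorationMixingScaleSpechtDimLinear
import Summits.ValiantsHypothesis.ValiantsHypothesis.Theorems.MonotoneRestorationMixingScaleSpechtDimSelfConjugate
import HarnessLib

/-!
# The minimal degree of `𝔄_n` is `n - 1` (James–Kerber 2.5.15): DISCHARGE of the named fact, and
# product mixing in `𝔄_n` (Babai–Nikolov–Pyber) as a theorem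

File 3/3 filed for route MonotoneRestoration, crux `OrbitRestorationQP` (stmt-ValiantsHypothesis-18293),
line `mixing-scale` (val-idea-12): its registered input `AlternatingMixing` is the named fact
`Literature.GroupTheory.QuasirandomGroups.alternatingProductMixing` (hypothesis `hmix` of
`stub_almostInvariantTerms`, `growingFaninRestoration_of`, …), which the tree reduces
(`alternatingProductMixing_of_minDegree`, Gowers' theorem being PROVED as `Gowers2008_thm_3_3_holds`) to the
typed fact `Literature.RepresentationTheory.FiniteGroups.JamesKerber1981_thm_2_5_15`:
for `n ∉ {3, 4, 5}` every non-trivial irreducible complex representation of `𝔄_n` has dimension `≥ n - 1`.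

* `JamesKerber1981_thm_2_5_15_holds : JamesKerber1981_thm_2_5_15` — **PROVED** (its statement verbatim);
* `alternatingProductMixing_holds : alternatingProductMixing` — hence PROVED.

## Proof (Clifford theory of index two over the Specht layer; not the printed branching-table argument)

For `n ≤ 2` the group is trivial (`alternatingGroup.eq_bot_of_card_le_two`), so let `n ≥ 6`, `ρ` irreducible on
`V`, `d = dim V`, some `ρ g ≠ 1`.  Then `d ≠ 1`: a line carries only scalars, which commute, so a
one-dimensional `ρ` kills `[𝔄_n, 𝔄_n] = 𝔄_n` (`commutator_alternatingGroup_eq_top`).  The character `χ` of `ρ`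
lies under an irreducible character `θ` of `𝔖_n` (an irreducible constituent of `Ind χ`, Frobenius
reciprocity `classInner_indClassFun_left`), and `θ = χ^μ` is a Specht character (`irrChars_perm_eq`) of
degree `f^μ` (`finrank_spechtIdeal_holds`).  By J–L 20.9 (`isIrrChar_restrict_or_of_index_two`) either
`θ↓𝔄_n = χ`, so `d = f^μ ≥ 2`, `μ` is neither a row nor a column (`χ^{(n)} = 1`, `χ^{(1ⁿ)} = sgn` restrict to
`1`) and `f^μ ≥ n - 1` by the linear bound `SpechtDim.linear_le_syt` (file 1/3); or `θ↓𝔄_n = ψ₁ + ψ₂` with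
`χ ∈ {ψ₁, ψ₂}`, `2d = f^μ`, `⟨θ↓, θ↓⟩ = 2 = [𝔖_n : 𝔄_n]` so `θ` vanishes off `𝔄_n` (J–L 20.5,
`classInner_restrict_eq_index_iff`), whence `χ^{μᵀ} = sgn · χ^{μ} = χ^{μ}` (`spechtCharacter_transpose`),
`μᵀ = μ` (`spechtCharacter_injective`), and `f^μ ≥ 2(n - 1)` by the self-conjugate bound
`SpechtDim.two_mul_le_syt_of_transpose_eq` (file 2/3).

References: G. James, A. Kerber, *The Representation Theory of the Symmetric Group*, Encyclopedia Math.
Appl. 16 (1981), Thm. 2.5.15; G. James, M. Liebeck, *Representations and Characters of Groups* (2001),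
Props. 20.5, 20.9, Thm. 20.13/Ex. 20.14; L. Babai, N. Nikolov, L. Pyber, SODA 2008, and W. T. Gowers,
*Quasirandom groups* (2008), Thm. 3.3.  Honest framing: two Literature facts become theorems; the crux
`OrbitRestorationQP`, the line's residual and `VP ≠ VNP` remain OPEN — nothing here is progress on `VP ≠ VNP`.
-/

noncomputable section

-- `Summit.ValiantsHypothesis.ValiantsHypothesis.…` is the tree's single-conjunct layout (Sub = Summit).
set_option linter.dupNamespace false

namespace Summit.ValiantsHypothesis.ValiantsHypothesis.Theorems.OrbitRestorationQPMixingScale.AlternatingMinimalDegree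

open Module Literature.RepresentationTheory.FiniteGroups Literature.NumberTheory.DiophantineGeometry
open Summit.MatrixMultiplication.MatrixMultiplication.Theorems.PolynomialSlack
open Summit.ValiantsHypothesis.ValiantsHypothesis.Theorems.OrbitRestorationQPMixingScale.SpechtDim

/-- An endomorphism of a one-dimensional space is a scalar. [folklore] -/
theorem exists_eq_smul_id_of_finrank_eq_one {V : Type*} [AddCommGroup V] [Module ℂ V]
    (h : finrank ℂ V = 1) (f : V →ₗ[ℂ] V) : ∃ c : ℂ, f = c • LinearMap.id := by
  obtain ⟨v, -, hspan⟩ := finrank_eq_one_iff'.mp h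
  obtain ⟨c, hc⟩ := hspan (f v)
  refine ⟨c, LinearMap.ext fun w => ?_⟩
  obtain ⟨a, rfl⟩ := hspan w
  rw [map_smul, ← hc, LinearMap.smul_apply, LinearMap.id_apply, smul_smul, smul_smul, mul_comm]

/-- A one-dimensional complex representation of the perfect group `𝔄_n` (`n ≥ 5`) is trivial.
[folklore] -/
theorem apply_eq_id_of_finrank_eq_one {n : ℕ} (h5 : 5 ≤ n) {V : Type*} [AddCommGroup V]
    [Module ℂ V] (ρ : Representation ℂ ↥(alternatingGroup (Fin n)) V) (h1 : finrank ℂ V = 1)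
    (g : ↥(alternatingGroup (Fin n))) : ρ g = LinearMap.id := by
  have hcomm : ∀ a b : ↥(alternatingGroup (Fin n)), ρ a * ρ b = ρ b * ρ a := by
    intro a b
    obtain ⟨ca, ha⟩ := exists_eq_smul_id_of_finrank_eq_one h1 (ρ a)
    obtain ⟨cb, hb⟩ := exists_eq_smul_id_of_finrank_eq_one h1 (ρ b)
    rw [ha, hb]
    ext v
    simp [smul_smul, mul_comm]
  have hker : commutator ↥(alternatingGroup (Fin n)) ≤ ρ.ker := by
    rw [commutator_def, Subgroup.commutator_le]
    intro a _ b _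
    rw [MonoidHom.mem_ker, commutatorElement_def,
      show a * b * a⁻¹ * b⁻¹ = (a * b) * (a⁻¹ * b⁻¹) by group, map_mul, map_mul ρ a b, hcomm a b,
      ← map_mul, ← map_mul, show b * a * (a⁻¹ * b⁻¹) = 1 by group, map_one]
  have htop : commutator ↥(alternatingGroup (Fin n)) = ⊤ :=
    commutator_alternatingGroup_eq_top (by simpa using h5)
  have hg : g ∈ ρ.ker := hker (htop ▸ Subgroup.mem_top g)
  rw [MonoidHom.mem_ker] at hg
  rw [hg]
  rfl

/-- **James–Kerber, Theorem 2.5.15 (i)–(ii), PROVED**: for `n ∉ {3, 4, 5}`, every irreducible complex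
representation of `𝔄_n = alternatingGroup (Fin n)` on which some element acts non-trivially has dimension
`≥ n - 1` — the named fact `Literature.RepresentationTheory.FiniteGroups.JamesKerber1981_thm_2_5_15`
verbatim (Clifford theory of index two over the tree's Specht layer, see the module docstring). -/
theorem JamesKerber1981_thm_2_5_15_holds : JamesKerber1981_thm_2_5_15 := by
  intro n h3 h4 h5 V _ _ _ ρ hρ hne
  obtain ⟨g0, hg0⟩ := hne
  -- `n ≥ 6`: for `n ≤ 2` the group is trivial
  have hn6 : 6 ≤ n := by
    by_contra hlt
    have hn2 : Nat.card (Fin n) ≤ 2 := by simp; omega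
    have hbot := alternatingGroup.eq_bot_of_card_le_two hn2
    apply hg0
    have hg1 : g0 = 1 := Subtype.ext (Subgroup.mem_bot.1 (hbot.le g0.2))
    rw [hg1, map_one]
    rfl
  -- `d ≠ 1` (perfectness) and `d ≠ 0`
  have hd1 : finrank ℂ V ≠ 1 := fun h1 => hg0 (apply_eq_id_of_finrank_eq_one (by omega) ρ h1 g0)
  have hd0 : finrank ℂ V ≠ 0 := by
    intro h0
    haveI : Subsingleton V := Module.finrank_zero_iff.mp h0
    exact hg0 (LinearMap.ext fun v => Subsingleton.elim _ _)
  -- the character of `ρ`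
  have hχ : IsIrrChar ↥(alternatingGroup (Fin n)) ρ.character := ⟨V, _, _, ‹_›, ρ, hρ, rfl⟩
  have hχ1 : ρ.character 1 = finrank ℂ V := ρ.char_one
  haveI : Nontrivial (Fin n) := Fin.nontrivial_iff_two_le.mpr (by omega)
  have hidx : (alternatingGroup (Fin n)).index = 2 := alternatingGroup.index_eq_two
  -- `χ` lies under an irreducible character `θ` of `𝔖_n`
  have hφ : IsCharacter (Equiv.Perm (Fin n)) (indClassFun (alternatingGroup (Fin n)) ρ.character) :=
    hχ.isCharacter.indClassFun _
  have hφ0 : indClassFun (alternatingGroup (Fin n)) ρ.character ≠ 0 := by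
    intro h0
    have h := congrFun h0 1
    rw [indClassFun_apply_one_eq_index_mul, hidx, hχ1, Pi.zero_apply] at h
    exact mul_ne_zero two_ne_zero (Nat.cast_ne_zero.mpr hd0) (by exact_mod_cast h)
  obtain ⟨θ, hθ, hθne⟩ := hφ.exists_isIrrChar_classInner_ne_zero hφ0
  rw [classInner_indClassFun_left _ _ hθ.isCharacter.isClassFun] at hθne
  -- from here on `hθne : ⟨χ, θ|H⟩ ≠ 0`
  obtain ⟨μ, hμ⟩ : ∃ μ : Nat.Partition n, spechtCharacter ℂ μ = θ := by
    have hmem : θ ∈ irrChars (Equiv.Perm (Fin n)) := hθ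
    rw [irrChars_perm_eq] at hmem
    exact hmem
  have hθ1 : θ 1 = numStandardTableaux μ := by
    rw [← hμ]
    show (spechtRep ℂ μ).character 1 = _
    rw [Representation.char_one, finrank_spechtIdeal_holds ℂ μ]
  have hYcard : μ.youngDiagram.cells.card = n := μ.card_cells_youngDiagram
  have hfY : numStandardTableaux μ = Nat.card (StdFilling μ.youngDiagram.cells.card μ.youngDiagram) :=
    numStandardTableaux_eq_card_stdFilling' μ
  -- the trivial character of `H` and `χ ≠ 1`
  have h11 : IsIrrChar ↥(alternatingGroup (Fin n)) (1 : ↥(alternatingGroup (Fin n)) → ℂ) := by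
    have h := character_trivial_mem_irrChars (G := ↥(alternatingGroup (Fin n)))
    have h1 : (Representation.trivial ℂ ↥(alternatingGroup (Fin n)) ℂ).character = 1 := by
      funext x; simp [Representation.character]
    rwa [h1] at h
  have hχne1 : ρ.character ≠ 1 := by
    intro hc
    have := congrFun hc 1
    rw [hχ1, Pi.one_apply] at this
    exact hd1 (by exact_mod_cast this)
  -- if `θ|H = 1` we are done by contradiction
  have hres_ne_one : (fun x : ↥(alternatingGroup (Fin n)) => θ x) ≠ 1 := by
    intro hres
    rw [hres, hχ.classInner_eq h11, if_neg hχne1] at hθne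
    exact hθne rfl
  -- exclude the one-row shape
  have hrow : μ.youngDiagram.rowLen 0 + 1 ≤ n := by
    by_contra hlt
    have hle : μ.youngDiagram.rowLen 0 ≤ μ.youngDiagram.cells.card := by
      rw [YoungDiagram.rowLen_eq_card]
      exact Finset.card_le_card fun c hc => (YoungDiagram.mem_cells _).2 (YoungDiagram.mem_row_iff.1 hc).1
    have heq : μ.youngDiagram.rowLen 0 = n := by omega
    rcases rowLen_zero_mem_parts_or μ with hmemp | hz
    · rcases sortedParts_of_exists_large_part μ hmemp (by omega) with hs | hs
      · apply hres_ne_one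
        funext x
        rw [← hμ, spechtCharacter_of_sortedParts_eq_single μ hs]
        rfl
      · have hmem' : μ.youngDiagram.rowLen 0 ∈ μ.sortedParts := (Multiset.mem_sort _).2 hmemp
        rw [hs, heq] at hmem'
        simp only [List.mem_cons, List.not_mem_nil, or_false] at hmem'
        omega
    · omega
  -- exclude the one-column shape
  have hcol : μ.youngDiagram.colLen 0 + 1 ≤ n := by
    by_contra hlt
    rw [colLen_zero_youngDiagram] at hlt
    rcases sortedParts_of_card_parts_ge μ (by omega) with hs | hs
    · apply hres_ne_one
      funext x
      rw [← hμ, spechtCharacter_of_sortedParts_eq_column μ (by omega) hs,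
        Equiv.Perm.mem_alternatingGroup.1 x.2]
      simp
    · have hc : μ.parts.card = n - 1 := by
        rw [← μ.length_sortedParts, hs, List.length_cons, List.length_replicate]
        omega
      omega
  -- J–L 20.9: `θ|H` is irreducible or a sum of two irreducibles of equal degree
  rcases isIrrChar_restrict_or_of_index_two (alternatingGroup (Fin n)) hidx hθ with
      hirr | ⟨ψ₁, ψ₂, hψ₁, hψ₂, hne12, hdeg, hsum⟩
  · -- non-split: `θ|H = χ`, so `d = f^μ`, and `μ` is neither a row nor a column
    have heq : ρ.character = fun x : ↥(alternatingGroup (Fin n)) => θ x := by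
      by_contra hne'
      rw [hχ.classInner_eq hirr, if_neg hne'] at hθne
      exact hθne rfl
    have hdf : (finrank ℂ V : ℂ) = numStandardTableaux μ := by
      rw [← hχ1, heq]
      exact hθ1
    have hdf' : finrank ℂ V = numStandardTableaux μ := by exact_mod_cast hdf
    have key := linear_le_syt (Y := μ.youngDiagram) (by omega) (by omega) (by omega)
    rw [← hfY, ← hdf'] at key
    omega
  · -- split: `χ ∈ {ψ₁, ψ₂}`, `2 d = f^μ`, `θ` vanishes off `H`, `μ = μᵗ`
    have hχψ : ρ.character = ψ₁ ∨ ρ.character = ψ₂ := by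
      by_contra hno
      push Not at hno
      apply hθne
      rw [hsum, classInner_comm, classInner_add_left, classInner_comm ψ₁, classInner_comm ψ₂,
        hχ.classInner_eq hψ₁, hχ.classInner_eq hψ₂, if_neg hno.1, if_neg hno.2, add_zero]
    have h2d : (numStandardTableaux μ : ℂ) = 2 * finrank ℂ V := by
      rw [← hθ1, ← hχ1]
      have h1 := congrFun hsum 1
      simp only [Pi.add_apply] at h1
      have e1 : θ 1 = θ ((1 : ↥(alternatingGroup (Fin n))) : Equiv.Perm (Fin n)) := rfl
      rw [e1, h1]
      rcases hχψ with h | h <;> rw [h] <;> [rw [hdeg]; rw [← hdeg]] <;> ring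
    have h2d' : numStandardTableaux μ = 2 * finrank ℂ V := by exact_mod_cast h2d
    -- `θ` vanishes off `H` (J–L 20.5 equality case: `⟨θ|H, θ|H⟩ = 2`)
    have hvan : ∀ g : Equiv.Perm (Fin n), g ∉ alternatingGroup (Fin n) → θ g = 0 := by
      rw [← hθ.classInner_restrict_eq_index_iff (alternatingGroup (Fin n)), hidx, hsum, classInner_add_left,
        classInner_comm ψ₁ (ψ₁ + ψ₂), classInner_comm ψ₂ (ψ₁ + ψ₂), classInner_add_left,
        classInner_add_left, hψ₁.classInner_eq hψ₁, hψ₂.classInner_eq hψ₁, hψ₁.classInner_eq hψ₂,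
        hψ₂.classInner_eq hψ₂, if_pos rfl, if_neg (Ne.symm hne12), if_neg hne12, if_pos rfl]
      norm_num
    -- hence `θ · sgn = θ`, i.e. `χ^{μᵗ} = χ^{μ}`, so `μᵗ = μ`
    have htr : spechtCharacter ℂ μ.transpose = spechtCharacter ℂ μ := by
      funext σ
      rw [spechtCharacter_transpose]
      by_cases hσ : σ ∈ alternatingGroup (Fin n)
      · rw [Equiv.Perm.mem_alternatingGroup.1 hσ]
        simp
      · rw [hμ, hvan σ hσ, mul_zero]
    have hμt : μ.transpose = μ := spechtCharacter_injective htr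
    have hYt : μ.youngDiagram.transpose = μ.youngDiagram := by
      rw [← Nat.Partition.youngDiagram_transpose, hμt]
    have key := two_mul_le_syt_of_transpose_eq hYt (by omega)
    rw [← hfY, h2d'] at key
    omega

/-- **Babai–Nikolov–Pyber product mixing in `𝔄_n`, PROVED** (the named fact
`Literature.GroupTheory.QuasirandomGroups.alternatingProductMixing`, via the tree's reduction
`alternatingProductMixing_of_minDegree` to the minimal degree of `𝔄_n`). -/
theorem alternatingProductMixing_holds : Literature.GroupTheory.QuasirandomGroups.alternatingProductMixing :=
  Literature.GroupTheory.QuasirandomGroups.alternatingProductMixing_of_minDegree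
    JamesKerber1981_thm_2_5_15_holds


end Summit.ValiantsHypothesis.ValiantsHypothesis.Theorems.OrbitRestorationQPMixingScale.AlternatingMinimalDegree

end
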